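import Literature.NumberTheory.PAdicHodge.AinfWeierstrassTorsionLiftAdd
import Mathlib.RingTheory.MvPowerSeries.Trunc
import HarnessLib

/-!
# `(p, ξ)`-adic truncation of `evalPt`: a point value of an integral power series is approximated by its total-degree truncations

Topic `Literature/NumberTheory/PAdicHodge`; namespace `Literature.NumberTheory.PAdicHodge.AinfTop`. THEOREMS ONLY (no definition, no instance, no named
fact, no `sorry`). For an integral power series `f ∈ ℤ⟦X_ι⟧` without constant term and a point `x` of the nil ideal `𝔫 = θ⁻¹(𝔪_ℂ)` of `AinfTop F p`
whose coordinates lie in the SMALL ideal `(p, ξ)`: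

* `isClosed_ideal_pow` — `(p, ξ)^n` is closed in `AinfTop` (an open subgroup of the adic topology);
* ★ `coe_evalPt_sub_aeval_truncTotal_mem` — `evalPt 𝔫 f x − (truncTotal_{D+1} f)(x) ∈ (p, ξ)^{D+1}` for every `D` (the tail `f − f_{≤D}` has all
  monomials of degree `≥ D + 1`, each evaluating into the closed ideal `(p,ξ)^{D+1}`; Mathlib `MvPowerSeries.hasSum_aeval`, `aeval_coe`);
* ★ `coe_addW_sub_aeval_truncTotal_mem` — in particular for the chord–tangent sum `a ⊕_W b = F_W(a, b)` on `Ŵ(𝔫)` (tree `AinfTop.addW`).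

This discharges the hypothesis `hg` of `GaloisContinuity.IsFormalLogModFil.add` (file `BdRPlusFormalLogModFil`): **`log_W(ι(a ⊕_W b)) ≡ log_W(ι a) + log_W(ι b)
(mod Fil^k B_dR⁺)`** for `a, b ∈ Ŵ((p, ξ)𝔸_inf)`. Floor (H4) step (3) of `Summits/…/Cruxes/StarredOptimalManinUnitFiveSeven/Lines/kato-lever-K3-B2-road.md`
(crux K★ `stmt-BirchSwinnertonDyer-22226`); infrastructure only — BSD / K★ are not proved by any of this.

## References
* J. W. S. Cassels, A. Fröhlich (eds.), *Algebraic Number Theory* (1967), Ch. VI §3.2 (points of formal groups in complete rings). [CasselsFrohlichANT1967]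
* J.-M. Fontaine, *Le corps des périodes p-adiques*, Astérisque 223 (1994), Exp. II §1.3. [FontaineAsterisque223III]
-/

noncomputable section

open Ideal Filter Topology WittVector MvPowerSeries

namespace Literature.NumberTheory.PAdicHodge

open Literature.NumberTheory.GaloisRepresentations
open Literature.NumberTheory.GaloisRepresentations.IsNonarchimedeanLocalField
open Literature.NumberTheory.GaloisRepresentations.LubinTate

namespace AinfTop

variable {F : Type} [Field F] [ValuativeRel F] [TopologicalSpace F] [IsNonarchimedeanLocalField F]
  {p : ℕ} [Fact p.Prime] [Fact (¬ IsUnit (p : integerC F))]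
  [IsAdicComplete (Ideal.span {(p : integerC F)}) (integerC F)] [CharZero F]
  {hθ : Function.Surjective (fontaineTheta (integerC F) p)}

omit [IsAdicComplete (Ideal.span {(p : integerC F)}) (integerC F)] [CharZero F] in
/-- **`(p, ξ)^n` is closed** in the `(p, ξ)`-adic ring `AinfTop F p` (it is an open additive subgroup). [cite: FontaineAsterisque223III, Exp. II §1.3] -/
theorem isClosed_ideal_pow (n : ℕ) : IsClosed (((WithIdeal.i : Ideal (AinfTop F p)) ^ n : Ideal (AinfTop F p)) : Set (AinfTop F p)) := by
  have h1 : (((WithIdeal.i : Ideal (AinfTop F p)) ^ n : Ideal (AinfTop F p)) : Set (AinfTop F p)) ∈ nhds (0 : AinfTop F p) :=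
    (Ideal.hasBasis_nhds_zero_adic (WithIdeal.i : Ideal (AinfTop F p))).mem_of_mem trivial
  exact (⟨((WithIdeal.i : Ideal (AinfTop F p)) ^ n).toAddSubgroup,
    ((WithIdeal.i : Ideal (AinfTop F p)) ^ n).toAddSubgroup.isOpen_of_mem_nhds h1⟩ : OpenAddSubgroup (AinfTop F p)).isClosed

omit [IsAdicComplete (Ideal.span {(p : integerC F)}) (integerC F)] [CharZero F] [Fact (¬ IsUnit (p : integerC F))] [Fact p.Prime]
  [ValuativeRel F] [TopologicalSpace F] [IsNonarchimedeanLocalField F] in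
/-- A monomial of total degree `≥ N` evaluates into `I^N` at a point of `I`. [folklore] -/
private theorem prod_pow_mem_pow {R : Type*} [CommRing R] {I : Ideal R} {ι : Type*} {y : ι → R} (hy : ∀ i, y i ∈ I)
    (d : ι →₀ ℕ) : (d.prod fun i e => y i ^ e) ∈ I ^ d.degree := by
  rw [Finsupp.prod, Finsupp.degree_apply, ← Finset.prod_pow_eq_pow_sum]
  exact Ideal.prod_mem_prod fun i _ => Ideal.pow_mem_pow (hy i) _

/-- ★ **Truncations approximate point values `(p, ξ)`-adically.** For `f ∈ ℤ⟦X_ι⟧` without constant term and a point `x` of `𝔫` with coordinates in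
`(p, ξ)`: `evalPt 𝔫 f x − (truncTotal_{D+1} f)(x) ∈ (p, ξ)^{D+1}`. [cite: CasselsFrohlichANT1967, Ch. VI §3.2] -/
theorem coe_evalPt_sub_aeval_truncTotal_mem {ι : Type*} [Finite ι] (f : MvPowerSeries ι ℤ) (hf : f.constantCoeff = 0)
    (x : ι → (nilTheta F p hθ).toIdeal) (hx : ∀ i, (x i : AinfTop F p) ∈ (WithIdeal.i : Ideal (AinfTop F p))) (D : ℕ) :
    ((evalPt (nilTheta F p hθ) f hf x : (nilTheta F p hθ).toIdeal) : AinfTop F p) -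
        MvPolynomial.aeval (fun i => (x i : AinfTop F p)) (truncTotal (D + 1) f) ∈
      (WithIdeal.i : Ideal (AinfTop F p)) ^ (D + 1) := by
  classical
  have hev := (nilTheta F p hθ).hasEval x
  -- split `f = f_{≤D} + f_hi`
  set g : MvPowerSeries ι ℤ := f - ((truncTotal (D + 1) f : MvPolynomial ι ℤ) : MvPowerSeries ι ℤ) with hg
  have hsplit : ((evalPt (nilTheta F p hθ) f hf x : (nilTheta F p hθ).toIdeal) : AinfTop F p) -
      MvPolynomial.aeval (fun i => (x i : AinfTop F p)) (truncTotal (D + 1) f) = MvPowerSeries.aeval hev g := by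
    rw [coe_evalPt, hg, map_sub, MvPowerSeries.aeval_coe]
  rw [hsplit]
  -- every term of the expansion of `g` lies in `I^{D+1}`
  have hterm : ∀ d : ι →₀ ℕ, MvPowerSeries.coeff d g • (d.prod fun i e => (x i : AinfTop F p) ^ e) ∈
      (WithIdeal.i : Ideal (AinfTop F p)) ^ (D + 1) := by
    intro d
    by_cases hd : d.degree < D + 1
    · have h0 : MvPowerSeries.coeff d g = 0 := by
        rw [hg, map_sub, MvPolynomial.coeff_coe, MvPowerSeries.coeff_truncTotal _ hd, sub_self]
      rw [h0, zero_smul]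
      exact Submodule.zero_mem _
    · exact Submodule.smul_of_tower_mem _ _ (Ideal.pow_le_pow_right (by omega) (prod_pow_mem_pow hx d))
  -- closedness of `I^{D+1}` and the `HasSum` expansion of `aeval`
  refine (isClosed_ideal_pow (F := F) (p := p) (D + 1)).mem_of_tendsto (MvPowerSeries.hasSum_aeval hev g)
    (Filter.Eventually.of_forall fun T => ?_)
  exact Ideal.sum_mem _ fun d _ => hterm d

/-- ★ **The chord–tangent sum is approximated by its truncations**: for `a, b ∈ Ŵ(𝔫)` with coordinates in `(p, ξ)`,
`(a ⊕_W b) − (truncTotal_{D+1} F_W)(a, b) ∈ (p, ξ)^{D+1}` — the hypothesis `hg` of `GaloisContinuity.IsFormalLogModFil.add`.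
[cite: CasselsFrohlichANT1967, Ch. VI §3.2] -/
theorem coe_addW_sub_aeval_truncTotal_mem (W : WeierstrassCurve ℤ) (a b : (nilTheta F p hθ).toIdeal)
    (ha : (a : AinfTop F p) ∈ (WithIdeal.i : Ideal (AinfTop F p))) (hb : (b : AinfTop F p) ∈ (WithIdeal.i : Ideal (AinfTop F p))) (D : ℕ) :
    ((addW W a b : (nilTheta F p hθ).toIdeal) : AinfTop F p) -
        MvPolynomial.aeval (fun i => ((![a, b] : Fin 2 → (nilTheta F p hθ).toIdeal) i : AinfTop F p)) (truncTotal (D + 1) W.formalGroupLaw) ∈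
      (WithIdeal.i : Ideal (AinfTop F p)) ^ (D + 1) :=
  coe_evalPt_sub_aeval_truncTotal_mem W.formalGroupLaw W.constantCoeff_formalGroupLaw ![a, b]
    (fun i => by fin_cases i <;> assumption) D

end AinfTop

end Literature.NumberTheory.PAdicHodge

end
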